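import Literature.AlgebraicGeometry.Modules.ModuleCechPrune
import Literature.AlgebraicGeometry.Motives.CartierDivisorSectionsOnCoherent
import Literature.AlgebraicGeometry.Motives.CartierDivisorLineBundleSectionsOn
import HarnessLib

/-!
# The module Čech complex of `𝒪_Y(D)` read in the function field: `Č•(𝓦, 𝒪_Y(D)) ≅ Č•(t ↦ Γ(W_t, 𝒪_Y(D)) ⊆ K(Y))`
# (Görtz–Wedhorn I (11.9); the bridge between the module model and the function-field model)

On an INTEGRAL scheme `Y` with base ring `ρ : A → Γ(Y, 𝒪_Y)` (so `K(Y)` is an `A`-algebra through the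
generic stalk, `Modules.ratFnAlgebra`), a Cartier divisor `D` and a finite family of NON-EMPTY opens
`𝓦 = (W_i)_i`, the sections `Γ(W_t, 𝒪_Y(D))` of the line bundle `𝒪_Y(D) = lineBundle D.toUnitCocycle` are read
inside `K(Y)` as the `A`-submodules `D.sectionsOn W_t` (★ `Motives/CartierDivisorSectionsOnCoherent`,
`Modules.sectionsOnFamily`, monotone in `t`), termwise by the `A`-linear isomorphisms
`Γ(W_s, 𝒪_Y(D)) ≃ₗ[A] D.sectionsOn W_s` of ★ `Motives/CartierDivisorLineBundleSectionsOn`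
(`CartierDivisor.lineBundleSectionsOnEquiv`; here `Modules.lineBundleSecModEquiv`), compatibly with
restriction ↦ inclusion. Hence (`Algebra/Homology/OrderedCechSystemMap`: `OrderedCech.sysComplexIsoNE`,
`OrderedCech.sysComplexIsoComplex`) the MODULE Čech complex of `Modules/ModuleCechComplex` is isomorphic over
`A` to the ordered Čech complex `OrderedCech.complex` of the function-field family — the statement
`Modules.LineBundleCechBridge` (a `Prop`, the typed interface of the M13 node (BR-1)) and its proof
**`Modules.lineBundleCechBridge_holds`**. This is how the finiteness of the coherent rank-one dévissage
(`Motives/CechCoherentDevissage`, function-field model) is transported to line bundles on possibly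
non-affine integral strata (`Modules/ModuleCechStratumFinite`). Everything is proved; no named facts.
Mathlib searched (pin): `Scheme.functionField`, `Presheaf.germ`, `RingHom.toAlgebra` (used); Mathlib has no
`𝒪_Y(D)` for Cartier divisors. Cell `hodgecm-mathlib`, M13 node N1 (1a-γ)/(BR-1) (B-p10 (g8) over B-typ02
(g10) p716532 and B-p04 p716066; cut/couriered by B-p15 (g8) per B-plan1 R140/R142); generic, books 0.

## References

* U. Görtz, T. Wedhorn, *Algebraic Geometry I: Schemes*, 2nd ed. (2020), Section (11.9) (Cartier divisors
  and the line bundle `𝒪_X(D)`), (11.13). [GortzWedhorn2020]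
* U. Görtz, T. Wedhorn, *Algebraic Geometry II: Cohomology of Schemes* (2023),
  doi:10.1007/978-3-658-43031-3: Def. 21.68 (p. 180). [GortzWedhorn2023]
* D. Mumford, *Abelian Varieties*, TIFR Studies in Mathematics 5 (1970), §5. [MumfordAV1970]
-/

universe u

open CategoryTheory CategoryTheory.Limits AlgebraicGeometry TopologicalSpace Opposite MonoidalCategory
open CartesianMonoidalCategory TensorProduct
open Literature.AlgebraicGeometry.Motives Literature.Algebra.Homology

set_option backward.isDefEq.respectTransparency false

noncomputable section

namespace Literature.AlgebraicGeometry.Modules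

/-! ### The function-field reading of the sections of `𝒪_Y(D)` (typed input, node (BR-1)) -/

section Bridge

variable {Y : Scheme.{u}} [IsIntegral Y] {A : Type u} [CommRing A] (ρ : A →+* Γ(Y, ⊤))

/-- The `A`-algebra structure on `K(Y)` through `ρ` and the generic stalk (the `AlgCompat` structure of
`Motives/CechCoherentDevissage`). [folklore] [cite: GortzWedhorn2020, Section (11.9)] -/
@[reducible] def ratFnAlgebra : Algebra A Y.functionField :=
  ((Y.presheaf.germ ⊤ (genericPoint Y) trivial).hom.comp ρ).toAlgebra

/-- Scalars are regular everywhere. [folklore] [cite: GortzWedhorn2020, Section (11.9)] -/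
theorem isRegularAt_ratFnAlgebra (a : A) (y : Y) :
    letI := ratFnAlgebra ρ
    RatFn.IsRegularAt y (algebraMap A Y.functionField a) := by
  letI := ratFnAlgebra ρ
  exact RatFn.isRegularAt_ofSection (U := ⊤) (x := y) trivial (ρ a)

variable {ι : Type} (𝓦 : ι → Y.Opens) (D : CartierDivisor Y)

/-- The coherent rank-one family `t ↦ Γ(V_t, 𝒪_Y(D)) ⊆ K(Y)` of `A`-submodules. [cite: GortzWedhorn2020, Section (11.9)] -/
def sectionsOnFamily : Finset ι → (letI := ratFnAlgebra ρ; Submodule A Y.functionField) :=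
  letI := ratFnAlgebra ρ
  fun t => D.sectionsOn (cechOpen 𝓦 t) fun a y _ => isRegularAt_ratFnAlgebra ρ a y

/-- The family is monotone (restriction is inclusion). [folklore] [cite: GortzWedhorn2020, Section (11.9)] -/
theorem sectionsOnFamily_mono : letI := ratFnAlgebra ρ; Monotone (sectionsOnFamily ρ 𝓦 D) := by
  letI := ratFnAlgebra ρ
  exact fun _ _ h => CartierDivisor.sectionsOn_mono (cechOpen_anti 𝓦 h) _ _

/-- **TYPED INPUT (node (BR-1), B-typ02 (g10)): the module Čech complex of `𝒪_Y(D) = lineBundle D.toUnitCocycle`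
on a cover by non-empty opens is isomorphic, over `A`, to the ordered Čech complex of the family
`t ↦ Γ(V_t, 𝒪_Y(D)) ⊆ K(Y)`** (sections of `lineBundle D.toUnitCocycle` read in `K(Y)` through the charts,
Görtz–Wedhorn I (11.9)). A `Prop`, never asserted. [cite: GortzWedhorn2020, Section (11.9)] -/
abbrev LineBundleCechBridge : Prop :=
  ∀ (Y : Scheme.{u}) [IsIntegral Y] (A : Type u) [CommRing A] (ρ : A →+* Γ(Y, ⊤)) (ι : Type) [LinearOrder ι]
    (𝓦 : ι → Y.Opens) (_ : ∀ i, ((𝓦 i : Set Y)).Nonempty) (D : CartierDivisor Y),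
    letI := ratFnAlgebra ρ
    Nonempty (cechComplex 𝓦 (lineBundle D.toUnitCocycle) ρ ≅
      OrderedCech.complex (sectionsOnFamily ρ 𝓦 D) (sectionsOnFamily_mono ρ 𝓦 D))

end Bridge


/-! ### Discharge of the bridge from ★ `CartierDivisor.lineBundleSectionsOnEquiv` (node (BR-1), B-typ02 p716532) -/

section BridgeHolds

variable {Y : Scheme.{u}} [IsIntegral Y] {A : Type u} [CommRing A] (ρ : A →+* Γ(Y, ⊤))
  {ι : Type} [LinearOrder ι] (𝓦 : ι → Y.Opens) (hne : ∀ i, ((𝓦 i : Set Y)).Nonempty) (D : CartierDivisor Y)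

/-- The termwise `A`-linear isomorphism `Γ(V_s, 𝒪_Y(D)) ≃ₗ[A] D.sectionsOn V_s` (★ `lineBundleSectionsOnEquiv`
with its `A`-linearity `lineBundleSectionsOnEquiv_algebraMap_smul`). [cite: GortzWedhorn2020, Section (11.9)] -/
def lineBundleSecModEquiv (s : Finset ι) :
    letI := ratFnAlgebra ρ
    SecMod (lineBundle D.toUnitCocycle) ρ (cechOpen 𝓦 s) ≃ₗ[A] sectionsOnFamily ρ 𝓦 D s :=
  letI := ratFnAlgebra ρ
  letI : Algebra A Γ(Y, cechOpen 𝓦 s) := (toSections ρ (cechOpen 𝓦 s)).toAlgebra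
  { (D.lineBundleSectionsOnEquiv (genericPoint_mem_cechOpen 𝓦 hne s)
      (fun a y _ => isRegularAt_ratFnAlgebra ρ a y)) with
    map_smul' := fun a x => by
      have hσ : ∀ a, RatFn.ofSection (genericPoint_mem_cechOpen 𝓦 hne s) (algebraMap A Γ(Y, cechOpen 𝓦 s) a) =
          algebraMap A Y.functionField a := fun a =>
        RatFn.ofSection_map (homOfLE le_top) (genericPoint_mem_cechOpen 𝓦 hne s) (ρ a)
      exact D.lineBundleSectionsOnEquiv_algebraMap_smul (genericPoint_mem_cechOpen 𝓦 hne s) _ hσ a (SecMod.val x) }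

omit [LinearOrder ι] in
/-- The termwise isomorphism read in `K(Y)`. [folklore] [cite: GortzWedhorn2020, Section (11.9)] -/
theorem coe_lineBundleSecModEquiv (s : Finset ι) (x : SecMod (lineBundle D.toUnitCocycle) ρ (cechOpen 𝓦 s)) :
    letI := ratFnAlgebra ρ
    ((lineBundleSecModEquiv ρ 𝓦 hne D s x : sectionsOnFamily ρ 𝓦 D s) : Y.functionField) =
      D.lineBundleRatFn (genericPoint_mem_cechOpen 𝓦 hne s) (SecMod.val x) := rfl

/-- **The bridge holds**: `Č•(𝓦, 𝒪_Y(D))` (module model) `≅ Č•(t ↦ Γ(V_t, 𝒪_Y(D)) ⊆ K(Y))` (function-field model),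
by F1 `sysComplexIsoNE` on ★ `lineBundleSectionsOnEquiv` (restriction ↦ inclusion: ★ `coe_lineBundleSectionsOnEquiv_map`)
followed by F1 `sysComplexIsoComplex`. [cite: GortzWedhorn2020, Section (11.9)] -/
theorem lineBundleCechBridge_holds : LineBundleCechBridge.{u} := by
  intro Y _ A _ ρ ι _ 𝓦 hne D
  letI := ratFnAlgebra ρ
  refine ⟨OrderedCech.sysComplexIsoNE (M' := OrderedCech.subfamilyFunctor (sectionsOnFamily ρ 𝓦 D)
      (sectionsOnFamily_mono ρ 𝓦 D)) (fun s _ => lineBundleSecModEquiv ρ 𝓦 hne D s) ?_ ≪≫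
    OrderedCech.sysComplexIsoComplex _ _⟩
  intro s t hs ht h x
  apply Subtype.ext
  change ((lineBundleSecModEquiv ρ 𝓦 hne D t (SecMod.res _ ρ (cechOpen_anti 𝓦 h) x) : sectionsOnFamily ρ 𝓦 D t) :
      Y.functionField) = ((lineBundleSecModEquiv ρ 𝓦 hne D s x : sectionsOnFamily ρ 𝓦 D s) : Y.functionField)
  rw [coe_lineBundleSecModEquiv, coe_lineBundleSecModEquiv, SecMod.val_res]
  exact D.lineBundleRatFn_map (homOfLE (cechOpen_anti 𝓦 h)) (genericPoint_mem_cechOpen 𝓦 hne t) (SecMod.val x)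

end BridgeHolds

end Literature.AlgebraicGeometry.Modules

end
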